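import Literature.Topology.FourManifolds.LoopSurgeryHomotopySphere
import Literature.Topology.FourManifolds.CircleSurgeryEulerCharacteristic
import Literature.Topology.FourManifolds.TrisectionEulerProofs
import Literature.Topology.FourManifolds.HomotopyS4CompactProofs
import HarnessLib

/-!
# Proofs for `LoopSurgeryHomotopySphere.lean`, II: `Σ kᵢ = g + 2` for a trisected loop partner of
# a homotopy 4-sphere (Gay–Kirby Remark 2 in general + `χ` of a circle surgery)

Sibling proof file of `Literature/Topology/FourManifolds/LoopSurgeryHomotopySphere.lean`
(D-0014: a named fact `def X : Prop` is discharged as `theorem X_holds : X`).  It proves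
`Literature.Topology.FourManifolds.gkTrisection_sum_eq_add_two_of_loopSurgery_homotopySphere_holds`:
the named fact `gkTrisection_sum_eq_add_two_of_loopSurgery_homotopySphere` — *if a closed
connected oriented smooth `X` has a `(g; k₀, k₁, k₂)`-GK-trisection and a surgery `M = X_ℓ` on a
smoothly embedded loop `ℓ ⊂ X` is homotopy equivalent to `S⁴`, then `k₀ + k₁ + k₂ = g + 2`* —
HOLDS.  The three inputs are all proved in the tree:

* `finRelHomology_and_relEuler_of_isGKTrisection` (this file) — **Gay–Kirby 2016 Remark 2 /
  Meier–Schirmer–Zupan 2016 Remark 3.12 in GENERAL**: a closed smooth `4`-manifold with a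
  `(g; k₀, k₁, k₂)`-GK-trisection has homology of finite type and
  `χ(X) = 2 + g - (k₀ + k₁ + k₂)`, `χ` being the tree's `relEuler ℤ ℤ X ∅`.  The proof is the
  inclusion–exclusion of the rational Čech Euler characteristic over the cover by the three
  sectors of the tree's `gkTrisection_genus_eq_sum_of_homotopyEquiv_sphere_holds`
  (`TrisectionEulerProofs.lean`, Part II; the homotopy-sphere case), with `χ(X)` kept symbolic
  through the finite type of the homology of a closed manifold
  (`finite_singularHomology_of_compactSpace_holds`, `isZero_singularHomology_of_lt_holds`) — the
  same generalisation is recorded on the Summits side as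
  `Summit.SmoothPoincare4.SmoothPoincare4.Theorems.WeakReductionReduces.LoopDichotomy.relEuler_eq_of_isGKTrisection`,
  which a Literature file may not import; here it is stated together with the finite type;
* `finRelHomology_and_relEuler_of_isCircleSurgery` (`CircleSurgeryEulerCharacteristic.lean`) —
  `χ(X_ℓ) = χ(X) + 2`;
* `finRelHomology_of_homotopyEquiv_sphere_four` (`TrisectionEulerProofs.lean`) — `χ(M) = 2` for
  `M ≃ₕ S⁴`, with `compactSpace_of_homotopyEquiv_sphere_four_holds`.

Hence `2 = χ(M) = χ(X) + 2 = 4 + g - Σ kᵢ`, i.e. `Σ kᵢ = g + 2`.  Everything is proved; no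
definitions, no named facts.

## References

* D. Gay, R. Kirby, *Trisecting 4-manifolds*, Geom. Topol. 20 (2016), Remark 2. [GayKirby2016]
* J. Meier, T. Schirmer, A. Zupan, Proc. AMS 144 (2016), arXiv:1507.06561, Remark 3.12.
  [MeierSchirmerZupan2016]
* R. E. Gompf, A. I. Stipsicz, *4-Manifolds and Kirby Calculus* (1999), §5.2. [GompfStipsiczGSM1999]
* A. Hatcher, *Algebraic Topology* (2002), Thm. 2.44, §3.3, Appendix A. [HatcherAT2002]
-/

noncomputable section

open scoped Manifold ContDiff Topology ContinuousMap
open Set Function CategoryTheory Limits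
open _root_.Topology
open Literature.AlgebraicTopology.SingularHomology Literature.AlgebraicTopology.Homotopy

namespace Literature.Topology.FourManifolds

universe u

-- adapted from `gkTrisection_genus_eq_sum_of_homotopyEquiv_sphere_holds`
-- (Literature/Topology/FourManifolds/TrisectionEulerProofs.lean, Part II): the same
-- inclusion–exclusion, with `χ(X)` kept symbolic and the finite type of `H_•(X)` recorded.
/-- **Gay–Kirby 2016, Remark 2 / Meier–Schirmer–Zupan 2016, Remark 3.12, GENERAL form, with the
finite type of the homology.**  A closed smooth `4`-manifold `X` with a `(g; k₀, k₁, k₂)`-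
trisection in the sense of `IsGKTrisection` has integral homology of finite type and Euler
characteristic `χ(X) = 2 + g − (k₀ + k₁ + k₂)` (MSZ, Remark 3.12: the induced handle
decomposition yields it, printed with the sign of `g − Σkᵢ` flipped; GK, Remark 2:
`χ(X) = 2 + g − 3k`), `χ` being the tree's `relEuler ℤ ℤ X ∅`.  Proof: inclusion–exclusion of
the rational Čech Euler characteristic over the cover by the three sectors (`Cech.euler_union₃`),
tautness of the compact pieces, the Morse equalities `χ(Xᵢ) = 1 − kᵢ`, `χ(Hᵢⱼ) = 1 − g`,
`χ(F) = 2 − 2g`, and `χ̌(X) = χ(X)` (finite type of the homology of a closed manifold).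
[cite: GayKirby2016, Remark 2] [cite: MeierSchirmerZupan2016, Remark 3.12] -/
theorem finRelHomology_and_relEuler_of_isGKTrisection {X : Type u} [TopologicalSpace X] [T2Space X]
    [SecondCountableTopology X] [ChartedSpace (EuclideanSpace ℝ (Fin 4)) X] [IsManifold (𝓡 4) ∞ X]
    [CompactSpace X] {g : ℕ} {k : Fin 3 → ℕ} {S : Fin 3 → Set X} (hT : IsGKTrisection X g k S) :
    FinRelHomology ℤ ℤ X ∅ 5 ∧ relEuler ℤ ℤ X ∅ = 2 + (g : ℤ) - ((k 0 + k 1 + k 2 : ℕ) : ℤ) := by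
  -- the rational coefficient object
  let Qu : ModuleCat.{u} ℚ := ModuleCat.of ℚ (ULift.{u} ℚ)
  -- `X` embeds in some `ℝᵐ` as a neighbourhood retract (compact manifolds are ENRs)
  obtain ⟨m, ι, hιc⟩ :=
    Literature.Geometry.Manifold.exists_isClosedEmbedding_pi_of_compactSpace
      (EuclideanSpace ℝ (Fin 4)) (M := X)
  have hι : IsEmbedding ι := hιc.isEmbedding
  have hX : IsNeighbourhoodRetract (range ι) :=
    isNeighbourhoodRetract_range_of_compactSpace isNeighbourhoodRetract_of_locallyContractibleSpace_holds
      (EuclideanSpace ℝ (Fin 4)) hι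
  obtain ⟨hcov, hsec, hpair⟩ := hT
  have hKc : ∀ i, IsCompact (S i) := fun i =>
    IsGKTrisection.isCompact (X := X) ⟨hcov, hsec, hpair⟩ i
  -- (a) the sectors: `χ̌(S i) = χ(W_i) = 1 - k i`
  have hSec : ∀ i, Cech.FinCech ℚ Qu (S i) 5 ∧ Cech.euler ℚ Qu (S i) = 1 - (k i : ℤ) := by
    intro i
    obtain ⟨W, _, _, f, hM, hW, -, hh, hf, hrange, -⟩ := hsec i
    haveI := hM; haveI := hW
    haveI : T2Space W := hf.t2Space
    haveI : SecondCountableTopology W := hf.secondCountableTopology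
    let φ : ↥(S i) ≃ₜ W := (hf.toHomeomorph.trans (Homeomorph.setCongr hrange)).symm
    obtain ⟨hP, hPe⟩ := relEuler_of_handleCount hh
    obtain ⟨hF, hFe⟩ := finCech_and_euler_of_homeomorph hι hX (hKc i) φ
      (locallyContractibleSpace_of_chartedSpace_halfSpace 4 W) hP
    exact ⟨hF, hFe.trans hPe⟩
  -- (b) the double intersections and (c) the central surface
  have hPair : ∀ i j, i ≠ j →
      (Cech.FinCech ℚ Qu (S i ∩ S j) 5 ∧ Cech.euler ℚ Qu (S i ∩ S j) = 1 - (g : ℤ)) ∧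
      (Cech.FinCech ℚ Qu (⋂ l, S l) 5 ∧ Cech.euler ℚ Qu (⋂ l, S l) = 2 - 2 * (g : ℤ)) := by
    intro i j hij
    obtain ⟨H, _, _, h, hM, hH, -, hh, hf, hrange, hbd⟩ := hpair i j hij
    haveI := hM; haveI := hH
    haveI : T2Space H := hf.isEmbedding.t2Space
    haveI : SecondCountableTopology H := hf.isEmbedding.secondCountableTopology
    have hKij : IsCompact (S i ∩ S j) := (hKc i).inter_right (hKc j).isClosed
    have hKI : IsCompact (⋂ l, S l) :=
      IsGKTrisection.isCompact_iInter (X := X) ⟨hcov, hsec, hpair⟩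
    constructor
    · let φ : ↥(S i ∩ S j) ≃ₜ H :=
        (hf.isEmbedding.toHomeomorph.trans (Homeomorph.setCongr hrange)).symm
      obtain ⟨hP, hPe⟩ := relEuler_of_handleCount hh
      obtain ⟨hF, hFe⟩ := finCech_and_euler_of_homeomorph hι hX hKij φ
        (locallyContractibleSpace_of_chartedSpace_halfSpace 3 H) (hP.mono (show 2 + 2 ≤ 5 by norm_num))
      exact ⟨hF, hFe.trans hPe⟩
    · let φ : ↥(⋂ l, S l) ≃ₜ ((𝓡∂ 3).boundary H) :=
        ((hf.isEmbedding.homeomorphImage ((𝓡∂ 3).boundary H)).trans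
          (Homeomorph.setCongr hbd)).symm
      obtain ⟨hP, hPe⟩ := relEuler_boundary_of_handleCount hh
      obtain ⟨hF, hFe⟩ := finCech_and_euler_of_homeomorph hι hX hKI φ
        (locallyContractibleSpace_of_chartedSpace (EuclideanSpace ℝ (Fin 2))
          (M := (𝓡∂ 3).boundary H)) (hP.mono (show 2 + 2 ≤ 5 by norm_num))
      refine ⟨hF, hFe.trans ?_⟩
      rw [hPe]
      ring
  -- (d) `X` itself: `χ̌(X) = χ(X)` (the homology of a closed manifold is of finite type)
  have hFX : FinRelHomology ℤ ℤ X ∅ 5 :=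
    FinRelHomology.empty_of_absolute
      (fun j => finite_singularHomology_of_compactSpace_holds ℤ X 4 j)
      (fun _ hj => isZero_singularHomology_of_lt_holds ℤ ℤ X 4 (by omega))
  have hUniv : Cech.FinCech ℚ Qu (univ : Set X) 5 ∧
      Cech.euler ℚ Qu (univ : Set X) = relEuler ℤ ℤ X ∅ :=
    finCech_and_euler_of_homeomorph hι hX isCompact_univ (Homeomorph.Set.univ X)
      (locallyContractibleSpace_of_chartedSpace (EuclideanSpace ℝ (Fin 4)) (M := X)) hFX
  -- inclusion–exclusion over the cover `X = S 0 ∪ S 1 ∪ S 2`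
  have hU : S 0 ∪ S 1 ∪ S 2 = univ := union_eq_univ_of_iUnion_fin_three hcov
  have hI : (⋂ l, S l) = S 0 ∩ S 1 ∩ S 2 := iInter_fin_three S
  obtain ⟨f₀₁, e₀₁⟩ := (hPair 0 1 (by decide)).1
  obtain ⟨f₀₂, e₀₂⟩ := (hPair 0 2 (by decide)).1
  obtain ⟨f₁₂, e₁₂⟩ := (hPair 1 2 (by decide)).1
  obtain ⟨fI, eI⟩ := (hPair 0 1 (by decide)).2
  rw [hI] at fI eI
  obtain ⟨-, hχ⟩ := Cech.euler_union₃ (hKc 0) (hKc 1) (hKc 2) (hSec 0).1 (hSec 1).1 (hSec 2).1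
    f₀₁ f₀₂ f₁₂ fI
  rw [hU, hUniv.2, (hSec 0).2, (hSec 1).2, (hSec 2).2, e₀₁, e₀₂, e₁₂, eI] at hχ
  refine ⟨hFX, ?_⟩
  push_cast
  linarith

/-- **`gkTrisection_sum_eq_add_two_of_loopSurgery_homotopySphere` holds**: if a closed smooth
`X` with a `(g; k₀, k₁, k₂)`-GK-trisection has a circle surgery `M = X_ℓ` which is homotopy
equivalent to `S⁴`, then `k₀ + k₁ + k₂ = g + 2` — for `χ(X) = 2 + g − Σ kᵢ`
(`finRelHomology_and_relEuler_of_isGKTrisection`), `χ(M) = χ(X) + 2`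
(`finRelHomology_and_relEuler_of_isCircleSurgery`) and `χ(M) = χ(S⁴) = 2`
(`finRelHomology_of_homotopyEquiv_sphere_four`; `M` is compact,
`compactSpace_of_homotopyEquiv_sphere_four_holds`).  Orientability, connectedness and the
smoothness of `ℓ` are not used. [cite: GayKirby2016, Remark 2] [cite: GompfStipsiczGSM1999, §5.2] -/
theorem gkTrisection_sum_eq_add_two_of_loopSurgery_homotopySphere_holds :
    gkTrisection_sum_eq_add_two_of_loopSurgery_homotopySphere := by
  intro X _ _ _ _ _ _ _ _ g k S hT ℓ _ M _ _ _ _ _ e hsurg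
  haveI : CompactSpace M := compactSpace_of_homotopyEquiv_sphere_four_holds M e
  obtain ⟨-, hχX⟩ := finRelHomology_and_relEuler_of_isGKTrisection hT
  obtain ⟨-, hχM⟩ := finRelHomology_of_homotopyEquiv_sphere_four e
  obtain ⟨-, -, hχ⟩ := finRelHomology_and_relEuler_of_isCircleSurgery hsurg
  have h2 : (2 : ℤ) = 2 + (g : ℤ) - ((k 0 + k 1 + k 2 : ℕ) : ℤ) + 2 := by
    rw [← hχX, ← hχ, hχM]
  push_cast at h2
  omega

end Literature.Topology.FourManifolds

end
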